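import Summits.QuantumFields.YangMills.Theorems.BalabanLadderUVSeamRecCeilingsDLRPeeling
import HarnessLib

/-!
# Crux `UVSeamRec` (stmt-QuantumFields-20043), lane B: the one-box uniform conditional rarity bound (UCR) at a FIXED scale is a CLASSICAL
# (zero-temperature) statement — Laplace's principle on a compact fibre, uniformly in the boundary data

Helper file (`--supports stmt-QuantumFields-20043`) of the width-lever seat `ym-20043-ceilings-p2` (lane B, gen 6); sequel of `…CeilingsDLRPeeling`
(the (UCR) ⇒ product-law reduction).  WHAT (UCR) ASKS at ONE scale.  The Wilson kernel of a finite link set `Λ` with exterior `η` is the product Haar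
measure on `G^Λ` tilted by `exp(−β S_Λ(ζ ∨ η))`, `S_Λ` the boundary Wilson action — a Gibbs measure on a COMPACT fibre whose energy depends continuously
on the COMPACT parameter `η`.  Laplace's principle, made uniform in the parameter by compactness, gives:

§1 (abstract, `exists_laplace_bound_of_minimisers_avoid`).  `X` compact with a finite Borel measure positive on open sets, `Y` compact,
`S : Y × X → ℝ` continuous, `E ⊆ X` closed such that for EVERY `y` NO minimiser of `S(y,·)` lies in `E`.  Then there are `C ≥ 0`, `Δ > 0` with
`∫_E e^{−βS(y,x)} dμ ≤ C e^{−βΔ} ∫_X e^{−βS(y,x)} dμ` for all `β ≥ 0` and ALL `y` (the gap `inf_E S(y,·) − min S(y,·)` is continuous and positive on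
compact `Y`; the denominators are bounded below uniformly by a finite-subcover argument).
§2 (kernels, `kernel_le_exp_of_minimisers_avoid`).  For the lattice Yang–Mills kernels `ymSpecification ρ β Λ η` of ANY finite link set `Λ` and a
closed set `E ⊆ G^Λ` of interior configurations avoided by every minimiser of `ζ ↦ S_Λ(ζ ∨ η)` for every exterior `η`:
`γ^η_Λ{U : U|_Λ ∈ E} ≤ C e^{−βΔ}` for all `β ≥ 0`, UNIFORMLY IN `η`; §3 the same in the `DlrCollarTransfer.kerE` letters of (UCR)
(`kerE_indicator_le_exp_of_minimisers_avoid`).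

READING for lane B.  At each FIXED level `k`, (UCR_k) with weight `w(β,k) = C_k e^{−βΔ_k}` FOLLOWS from the CLASSICAL no-penetration property «for
every exterior, every minimiser of the collar-cube Wilson action keeps the central `k`-block field below the threshold» (closure of the event read on
the interior links, `m ≥ b+1`) — the one-box analogue of the far-UV rung (fixed `k`, `β → ∞`); `C_k` (entropy of the fibre `G^Λ`, `#Λ ≍ (2m+1)⁴b^{4k}`)
and `Δ_k` are NOT uniform in `k`: the summability over `k ≲ log_b R` asked by (RM) is the renormalisation-group content, untouched.  HONEST FRAMING:
folklore (Laplace principle at zero temperature, compactness); the classical property is itself OPEN (flat penetration forces central block fields up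
to `1 − cos(π²/(2m+1)²)`, LEAD 20043 FINDING #50); nothing of E0′; not a gap, not Clay.
-/

set_option autoImplicit false

noncomputable section

open MeasureTheory Filter Topology Set
open Literature.Probability.LatticeModels
open Literature.MathematicalPhysics.QuantumFieldTheory (GaugeConfig LatticeRep haarProbability)
open Literature.MathematicalPhysics.QuantumLattice (LGConfig IsCylinder ymSpecification isProbabilityMeasure_ymSpecification
  integrable_of_abs_le wilsonBoundaryAction continuous_wilsonBoundaryAction continuous_glueWith_prod integral_ymSpecification)

namespace Summit.QuantumFields.YangMills.Cruxes.UVSeamRec.DLRPeeling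

/-! ## §1 Laplace's principle on a compact fibre, uniformly in a compact parameter -/

section Laplace

variable {X Y : Type*} [TopologicalSpace X] [CompactSpace X] [TopologicalSpace Y] [CompactSpace Y]

omit [CompactSpace X] in
/-- A continuous function on a nonempty compact set attains its infimum: a point of the set where the value is the `sInf` of the image
and is below every other value. [folklore] -/
theorem exists_eq_sInf_image_of_isCompact {K : Set X} (hK : IsCompact K) (hne : K.Nonempty) {f : X → ℝ} (hf : Continuous f) :
    ∃ x ∈ K, f x = sInf (f '' K) ∧ ∀ x' ∈ K, f x ≤ f x' := by
  obtain ⟨x, hxK, hmin⟩ := hK.exists_isMinOn hne hf.continuousOn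
  have hmin' : ∀ x' ∈ K, f x ≤ f x' := fun x' hx' => hmin hx'
  refine ⟨x, hxK, ?_, hmin'⟩
  refine (IsLeast.csInf_eq ⟨mem_image_of_mem f hxK, ?_⟩).symm
  rintro _ ⟨x', hx', rfl⟩
  exact hmin' x' hx'

omit [CompactSpace Y] in
/-- Along a jointly continuous `S : Y × X → ℝ` on compact spaces, values are uniformly close for nearby parameters: the set of `y` with
`sup_x |S(y,x) − S(y₀,x)| < δ` is an open neighbourhood of `y₀`, on which `|S(y,x) − S(y₀,x)| < δ` for every `x`. [folklore] -/
theorem isOpen_uniformlyClose {S : Y → X → ℝ} (hS : Continuous ↿S) (y₀ : Y) (δ : ℝ) :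
    IsOpen {y : Y | sSup ((fun x => |S y x - S y₀ x|) '' univ) < δ} ∧
      ∀ y, sSup ((fun x => |S y x - S y₀ x|) '' univ) < δ → ∀ x, |S y x - S y₀ x| < δ := by
  have hg : Continuous ↿(fun (y : Y) (x : X) => |S y x - S y₀ x|) := by
    have h1 : Continuous fun p : Y × X => S p.1 p.2 := hS
    have h2 : Continuous fun p : Y × X => S y₀ p.2 := hS.comp ((continuous_const).prodMk continuous_snd)
    exact (h1.sub h2).abs
  refine ⟨(isCompact_univ.continuous_sSup hg).isOpen_preimage _ isOpen_Iio, fun y hy x => lt_of_le_of_lt ?_ hy⟩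
  have hcont : Continuous fun x => |S y x - S y₀ x| := hg.comp (Continuous.prodMk_right y)
  exact le_csSup ((isCompact_univ.image hcont).bddAbove) (mem_image_of_mem _ (mem_univ x))

variable [MeasurableSpace X] [OpensMeasurableSpace X] (μ : Measure X) [IsFiniteMeasure μ] [μ.IsOpenPosMeasure]

/-- **LAPLACE'S PRINCIPLE ON A COMPACT FIBRE, UNIFORMLY IN A COMPACT PARAMETER.**  `X` compact with a finite Borel measure `μ` positive on
nonempty open sets, `Y` compact, `S : Y × X → ℝ` continuous, `E ⊆ X` closed, and for EVERY `y` no minimiser of `S(y,·)` lies in `E`.  Then there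
are `C ≥ 0` and `Δ > 0` such that for all `β ≥ 0` and ALL `y`:  `∫_E e^{−βS(y,x)} dμ(x) ≤ C·e^{−βΔ}·∫_X e^{−βS(y,x)} dμ(x)` — the Gibbs probability of
`E` at inverse temperature `β` is exponentially small, uniformly in the parameter.  Proof: the gap `g(y) = inf_E S(y,·) − min S(y,·)` is continuous
(`IsCompact.continuous_sInf`) and positive, hence `≥ 2Δ > 0` on compact `Y`; on `E` the integrand is `≤ e^{−β(min+2Δ)}`; the partition function is
`≥ e^{−β(min+Δ)}·μ{S(y,·) < min + Δ}`, and these measures are bounded below uniformly in `y` by a finite subcover of `Y` by sets of parameters with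
uniformly close energies. [folklore] -/
theorem exists_laplace_bound_of_minimisers_avoid {S : Y → X → ℝ} (hS : Continuous ↿S) {E : Set X} (hE : IsClosed E)
    (havoid : ∀ y x, (∀ x', S y x ≤ S y x') → x ∉ E) :
    ∃ C Δ : ℝ, 0 ≤ C ∧ 0 < Δ ∧ ∀ β : ℝ, 0 ≤ β → ∀ y : Y,
      ∫ x in E, Real.exp (-β * S y x) ∂μ ≤ C * Real.exp (-β * Δ) * ∫ x, Real.exp (-β * S y x) ∂μ := by
  classical
  have hSy : ∀ y, Continuous (S y) := fun y => hS.comp (Continuous.prodMk_right y)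
  have hexp_int : ∀ (β : ℝ) (y : Y), Integrable (fun x => Real.exp (-β * S y x)) μ := by
    intro β y
    have hc : Continuous fun x => Real.exp (-β * S y x) := Real.continuous_exp.comp (continuous_const.mul (hSy y))
    obtain ⟨B, hB⟩ := (isCompact_univ.image hc).isBounded.exists_norm_le
    refine integrable_of_abs_le hc.measurable (C := B) fun x => ?_
    rw [← Real.norm_eq_abs]
    exact hB _ (mem_image_of_mem _ (mem_univ x))
  rcases E.eq_empty_or_nonempty with hEe | hEne
  · refine ⟨0, 1, le_rfl, one_pos, fun β _ y => ?_⟩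
    rw [hEe, Measure.restrict_empty, integral_zero_measure, zero_mul, zero_mul]
  obtain ⟨x₀, hx₀E⟩ := hEne
  haveI : Nonempty X := ⟨x₀⟩
  rcases isEmpty_or_nonempty Y with hY | hY
  · exact ⟨0, 1, le_rfl, one_pos, fun β _ y => (IsEmpty.false y).elim⟩
  set m : Y → ℝ := fun y => sInf (S y '' univ) with hmdef
  set mE : Y → ℝ := fun y => sInf (S y '' E) with hmEdef
  have hm : Continuous m := isCompact_univ.continuous_sInf hS
  have hmE : Continuous mE := hE.isCompact.continuous_sInf hS
  have hmin : ∀ y, ∃ x, S y x = m y ∧ ∀ x', S y x ≤ S y x' := fun y => by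
    obtain ⟨x, -, hx, hle⟩ := exists_eq_sInf_image_of_isCompact isCompact_univ univ_nonempty (hSy y)
    exact ⟨x, hx, fun x' => hle x' (mem_univ _)⟩
  have hminE : ∀ y, ∃ x ∈ E, S y x = mE y ∧ ∀ x' ∈ E, S y x ≤ S y x' := fun y =>
    exists_eq_sInf_image_of_isCompact hE.isCompact ⟨x₀, hx₀E⟩ (hSy y)
  have hm_le : ∀ y x, m y ≤ S y x := fun y x => by
    obtain ⟨x₁, hx₁, hle⟩ := hmin y; rw [← hx₁]; exact hle x
  have hmE_le : ∀ y, ∀ x ∈ E, mE y ≤ S y x := fun y x hx => by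
    obtain ⟨x₁, -, hx₁, hle⟩ := hminE y; rw [← hx₁]; exact hle x hx
  have hgap : ∀ y, 0 < mE y - m y := fun y => by
    obtain ⟨xE, hxE, hSxE, -⟩ := hminE y
    by_contra hle
    push Not at hle
    have hglob : ∀ x', S y xE ≤ S y x' := fun x' => by rw [hSxE]; linarith [hm_le y x']
    exact havoid y xE hglob hxE
  obtain ⟨y₁, -, hy₁⟩ := isCompact_univ.exists_isMinOn univ_nonempty ((hmE.sub hm).continuousOn)
  set Δ : ℝ := (mE y₁ - m y₁) / 2 with hΔdef
  have hΔpos : 0 < Δ := by rw [hΔdef]; linarith [hgap y₁]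
  have hΔle : ∀ y, 2 * Δ ≤ mE y - m y := fun y => by
    have := hy₁ (mem_univ y); simp only [mem_setOf_eq, Pi.sub_apply] at this; rw [hΔdef]; linarith
  set U : Y → Set X := fun y₀ => {x | S y₀ x < m y₀ + Δ / 2} with hUdef
  set V : Y → Set Y := fun y₀ => {y | sSup ((fun x => |S y x - S y₀ x|) '' univ) < Δ / 4} with hVdef
  have hUopen : ∀ y₀, IsOpen (U y₀) := fun y₀ => isOpen_lt (hSy y₀) continuous_const
  have hUpos : ∀ y₀, 0 < μ.real (U y₀) := fun y₀ => by
    obtain ⟨x₁, hx₁, -⟩ := hmin y₀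
    have hne : (U y₀).Nonempty := ⟨x₁, by simp only [hUdef, mem_setOf_eq, hx₁]; linarith⟩
    exact ENNReal.toReal_pos ((hUopen y₀).measure_pos μ hne).ne' (measure_ne_top μ _)
  have hVopen : ∀ y₀, IsOpen (V y₀) := fun y₀ => (isOpen_uniformlyClose hS y₀ (Δ / 4)).1
  have hVmem : ∀ y₀, y₀ ∈ V y₀ := fun y₀ => by
    simp only [hVdef, mem_setOf_eq, sub_self, abs_zero]
    have : (fun _ : X => (0 : ℝ)) '' univ = {0} := by
      ext t; simp only [mem_image, mem_univ, true_and, mem_singleton_iff]; exact ⟨fun ⟨_, h⟩ => h.symm, fun h => ⟨x₀, h.symm⟩⟩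
    rw [this, csSup_singleton]; linarith
  have hUV : ∀ y₀, ∀ y ∈ V y₀, U y₀ ⊆ {x | S y x < m y + Δ} := by
    intro y₀ y hy x hx
    have hclose := (isOpen_uniformlyClose hS y₀ (Δ / 4)).2 y hy
    simp only [hUdef, mem_setOf_eq] at hx ⊢
    -- `m y ≥ m y₀ − Δ/4`
    obtain ⟨xy, hxy, -⟩ := hmin y
    have h1 := abs_lt.1 (hclose xy)
    have h2 := hm_le y₀ xy
    have h3 := abs_lt.1 (hclose x)
    linarith
  obtain ⟨t, ht⟩ := isCompact_univ.elim_finite_subcover V hVopen (fun y _ => mem_iUnion.2 ⟨y, hVmem y⟩)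
  have htne : t.Nonempty := by
    obtain ⟨y⟩ := hY
    have := ht (mem_univ y)
    simp only [mem_iUnion] at this
    obtain ⟨i, hi, -⟩ := this
    exact ⟨i, hi⟩
  set c : ℝ := t.inf' htne fun i => μ.real (U i) with hcdef
  have hcpos : 0 < c := by
    rw [hcdef, Finset.lt_inf'_iff]; exact fun i _ => hUpos i
  have hden : ∀ y, c ≤ μ.real {x | S y x < m y + Δ} := fun y => by
    have := ht (mem_univ y)
    simp only [mem_iUnion] at this
    obtain ⟨i, hi, hyi⟩ := this
    calc c ≤ μ.real (U i) := Finset.inf'_le _ hi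
      _ ≤ μ.real {x | S y x < m y + Δ} := by
          exact ENNReal.toReal_mono (measure_ne_top μ _) (measure_mono (hUV i y hyi))
  -- the bound
  refine ⟨μ.real univ / c, Δ, by positivity, hΔpos, fun β hβ y => ?_⟩
  have hWmeas : MeasurableSet {x | S y x < m y + Δ} := (isOpen_lt (hSy y) continuous_const).measurableSet
  have hnum : ∫ x in E, Real.exp (-β * S y x) ∂μ ≤ μ.real univ * Real.exp (-β * (m y + 2 * Δ)) := by
    calc ∫ x in E, Real.exp (-β * S y x) ∂μ ≤ ∫ x in E, Real.exp (-β * (m y + 2 * Δ)) ∂μ := by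
          refine setIntegral_mono_on (hexp_int β y).integrableOn (integrableOn_const (measure_ne_top μ _)) hE.measurableSet
            fun x hx => Real.exp_le_exp.2 ?_
          have := hmE_le y x hx
          have := hΔle y
          nlinarith
      _ = μ.real E * Real.exp (-β * (m y + 2 * Δ)) := by rw [setIntegral_const, smul_eq_mul]
      _ ≤ μ.real univ * Real.exp (-β * (m y + 2 * Δ)) :=
          mul_le_mul_of_nonneg_right (ENNReal.toReal_mono (measure_ne_top μ _) (measure_mono (subset_univ _)))
            (Real.exp_pos _).le
  have hdenom : c * Real.exp (-β * (m y + Δ)) ≤ ∫ x, Real.exp (-β * S y x) ∂μ := by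
    calc c * Real.exp (-β * (m y + Δ)) ≤ Real.exp (-β * (m y + Δ)) * μ.real {x | S y x < m y + Δ} := by
          rw [mul_comm]; exact mul_le_mul_of_nonneg_left (hden y) (Real.exp_pos _).le
      _ ≤ ∫ x in {x | S y x < m y + Δ}, Real.exp (-β * S y x) ∂μ := by
          refine setIntegral_ge_of_const_le_real hWmeas (measure_ne_top μ _) (fun x hx => Real.exp_le_exp.2 ?_)
            (hexp_int β y).integrableOn
          simp only [mem_setOf_eq] at hx
          nlinarith
      _ ≤ ∫ x, Real.exp (-β * S y x) ∂μ := setIntegral_le_integral (hexp_int β y) (ae_of_all _ fun x => (Real.exp_pos _).le)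
  -- assembly
  have hc0 : c ≠ 0 := hcpos.ne'
  have hexp : Real.exp (-β * (m y + 2 * Δ)) = Real.exp (-β * Δ) * Real.exp (-β * (m y + Δ)) := by
    rw [← Real.exp_add]; ring_nf
  calc ∫ x in E, Real.exp (-β * S y x) ∂μ ≤ μ.real univ * Real.exp (-β * (m y + 2 * Δ)) := hnum
    _ = μ.real univ / c * Real.exp (-β * Δ) * (c * Real.exp (-β * (m y + Δ))) := by
        rw [hexp]; field_simp
    _ ≤ μ.real univ / c * Real.exp (-β * Δ) * ∫ x, Real.exp (-β * S y x) ∂μ :=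
        mul_le_mul_of_nonneg_left hdenom (by positivity)

end Laplace

/-! ## §2 Lattice Yang–Mills kernels: an exterior-uniform exponential bound from a classical no-minimiser property -/

section Kernel

variable {d N : ℕ} {G : Type*} [Group G] [TopologicalSpace G] [IsTopologicalGroup G] [CompactSpace G]
  [MeasurableSpace G] [BorelSpace G] [SecondCountableTopology G] (ρ : G →* Matrix (Fin N) (Fin N) ℂ)

omit [Group G] [TopologicalSpace G] [IsTopologicalGroup G] [CompactSpace G] [MeasurableSpace G] [BorelSpace G]
  [SecondCountableTopology G] in
/-- Restricting the glued configuration to `Λ` returns the interior data. [folklore] -/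
theorem restrict_glueWith (Λ : Finset (Literature.MathematicalPhysics.QuantumLattice.ZdEdge d)) (ζ : ↥Λ → G) (η : LGConfig d G) :
    (fun e : ↥Λ => glueWith Λ ζ η e) = ζ := by
  funext e
  rw [glueWith_apply_mem _ _ _ e.2]

/-- **KERNEL FORM: a classical no-minimiser property gives an exponential bound UNIFORM IN THE EXTERIOR.**  `G` compact, `ρ` continuous, `Λ` any
finite link set, `E ⊆ G^Λ` a CLOSED set of interior configurations such that for EVERY exterior `η` no minimiser `ζ` of the boundary Wilson action
`ζ ↦ S_Λ(ζ ∨ η)` lies in `E`.  Then there are `C ≥ 0`, `Δ > 0` with `γ^η_Λ{U : U|_Λ ∈ E} ≤ C e^{−βΔ}` for all `β ≥ 0` and ALL `η`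
(`γ = ymSpecification ρ β Λ`): §1 on the compact fibre `G^Λ` (product Haar, positive on open sets) with the compact parameter space of
exteriors, and the tree's integral formula `integral_ymSpecification`. [folklore] -/
theorem kernel_le_exp_of_minimisers_avoid (hρ : Continuous ρ) (Λ : Finset (Literature.MathematicalPhysics.QuantumLattice.ZdEdge d))
    {E : Set (↥Λ → G)} (hE : IsClosed E)
    (havoid : ∀ (η : LGConfig d G) (ζ : ↥Λ → G),
      (∀ ζ', wilsonBoundaryAction ρ Λ (glueWith Λ ζ η) ≤ wilsonBoundaryAction ρ Λ (glueWith Λ ζ' η)) → ζ ∉ E) :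
    ∃ C Δ : ℝ, 0 ≤ C ∧ 0 < Δ ∧ ∀ β : ℝ, 0 ≤ β → ∀ η : LGConfig d G,
      ∫ U, ({U : LGConfig d G | (fun e : ↥Λ => U e) ∈ E}).indicator (fun _ => (1 : ℝ)) U ∂(ymSpecification ρ β Λ η) ≤
        C * Real.exp (-β * Δ) := by
  classical
  have hS : Continuous ↿(fun (η : LGConfig d G) (ζ : ↥Λ → G) => wilsonBoundaryAction ρ Λ (glueWith Λ ζ η)) :=
    (continuous_wilsonBoundaryAction ρ hρ Λ).comp (continuous_glueWith_prod Λ)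
  haveI : IsFiniteMeasure (Measure.pi fun _ : ↥Λ => haarProbability G) := inferInstance
  haveI : (Measure.pi fun _ : ↥Λ => haarProbability G).IsOpenPosMeasure := inferInstance
  obtain ⟨C, Δ, hC, hΔ, hmain⟩ := exists_laplace_bound_of_minimisers_avoid (Y := LGConfig d G)
    (Measure.pi fun _ : ↥Λ => haarProbability G) hS hE (fun η ζ h => havoid η ζ h)
  refine ⟨C, Δ, hC, hΔ, fun β hβ η => ?_⟩
  set A : Set (LGConfig d G) := {U | (fun e : ↥Λ => U e) ∈ E} with hAdef
  have hAm : MeasurableSet A := (measurable_pi_lambda _ fun e => measurable_pi_apply _) hE.measurableSet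
  have hFm : Measurable (A.indicator fun _ => (1 : ℝ)) := measurable_const.indicator hAm
  rw [integral_ymSpecification ρ hρ β Λ hFm]
  -- the numerator is the restricted integral over `E`, the denominator is positive
  have hind : ∀ ζ, A.indicator (fun _ => (1 : ℝ)) (glueWith Λ ζ η) = E.indicator (fun _ => (1 : ℝ)) ζ := by
    intro ζ
    simp only [hAdef, Set.indicator_apply, mem_setOf_eq, restrict_glueWith]
  have hnum : ∫ ζ, A.indicator (fun _ => (1 : ℝ)) (glueWith Λ ζ η) * Real.exp (-β * wilsonBoundaryAction ρ Λ (glueWith Λ ζ η))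
      ∂(Measure.pi fun _ : ↥Λ => haarProbability G) =
      ∫ ζ in E, Real.exp (-β * wilsonBoundaryAction ρ Λ (glueWith Λ ζ η)) ∂(Measure.pi fun _ : ↥Λ => haarProbability G) := by
    rw [← integral_indicator hE.measurableSet]
    refine integral_congr_ae (ae_of_all _ fun ζ => ?_)
    show A.indicator (fun _ => (1 : ℝ)) (glueWith Λ ζ η) * Real.exp (-β * wilsonBoundaryAction ρ Λ (glueWith Λ ζ η)) =
      E.indicator (fun ζ => Real.exp (-β * wilsonBoundaryAction ρ Λ (glueWith Λ ζ η))) ζ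
    rw [hind ζ]
    by_cases hζ : ζ ∈ E
    · simp only [Set.indicator_of_mem hζ, one_mul]
    · simp only [Set.indicator_of_notMem hζ, zero_mul]
  have hglue : Continuous fun ζ : ↥Λ → G => glueWith Λ ζ η := (continuous_glueWith_prod Λ).comp (Continuous.prodMk_right η)
  have hSc : Continuous fun ζ : ↥Λ → G => Real.exp (-β * wilsonBoundaryAction ρ Λ (glueWith Λ ζ η)) :=
    Real.continuous_exp.comp (continuous_const.mul ((continuous_wilsonBoundaryAction ρ hρ Λ).comp hglue))
  obtain ⟨B, hB⟩ := (isCompact_univ.image hSc).isBounded.exists_norm_le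
  have hint : Integrable (fun ζ : ↥Λ → G => Real.exp (-β * wilsonBoundaryAction ρ Λ (glueWith Λ ζ η)))
      (Measure.pi fun _ : ↥Λ => haarProbability G) := by
    refine integrable_of_abs_le hSc.measurable (C := B) fun x => ?_
    rw [← Real.norm_eq_abs]
    exact hB _ (mem_image_of_mem _ (mem_univ x))
  have hZpos : 0 < ∫ ζ, Real.exp (-β * wilsonBoundaryAction ρ Λ (glueWith Λ ζ η)) ∂(Measure.pi fun _ : ↥Λ => haarProbability G) :=
    integral_exp_pos hint
  rw [hnum, div_le_iff₀ hZpos]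
  exact hmain β hβ η

end Kernel

/-! ## §3 In the letters of (UCR): cube kernels and N20's large-field event -/

section UCR

open Summit.QuantumFields.YangMills.Cruxes.OSLegsFromFemtoAndGap.DlrCollarTransfer
open Summit.QuantumFields.YangMills.Cruxes.OSLegsFromFemtoAndGap.DlrCollarTransfer.StubLower (mem_cubeSites_iff)
open Summit.QuantumFields.YangMills.Cruxes.UVSeamRec.PolymerData

variable (G : Type) [Group G] [TopologicalSpace G] [IsTopologicalGroup G] [CompactSpace G]
  [MeasurableSpace G] [BorelSpace G] (r : LatticeRep G)

/-- **Cube-kernel form.**  Cube `Q = (c, b)`, a closed set `E ⊆ G^{cubeEdges c b}` of interior configurations avoided, for EVERY exterior, by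
every minimiser of the cube's boundary Wilson action; then `kerE^η_Q(1_{U|_Q ∈ E}) ≤ C e^{−βΔ}` for all `β ≥ 0`, uniformly in `η`. [folklore] -/
theorem kerE_indicator_le_exp_of_minimisers_avoid (c : Fin 4 → ℤ) (b : ℕ) {E : Set (↥(cubeEdges c b) → G)} (hE : IsClosed E)
    (havoid : ∀ (η : LGConfig 4 G) (ζ : ↥(cubeEdges c b) → G),
      (∀ ζ', wilsonBoundaryAction r.ρ (cubeEdges c b) (glueWith (cubeEdges c b) ζ η) ≤
        wilsonBoundaryAction r.ρ (cubeEdges c b) (glueWith (cubeEdges c b) ζ' η)) → ζ ∉ E) :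
    ∃ C Δ : ℝ, 0 ≤ C ∧ 0 < Δ ∧ ∀ β : ℝ, 0 ≤ β → ∀ η : LGConfig 4 G,
      kerE G r β c b η (({U : LGConfig 4 G | (fun e : ↥(cubeEdges c b) => U e) ∈ E}).indicator fun _ => (1 : ℝ)) ≤
        C * Real.exp (-β * Δ) := by
  haveI := r.secondCountableTopology
  obtain ⟨C, Δ, hC, hΔ, h⟩ := kernel_le_exp_of_minimisers_avoid r.ρ r.continuous (cubeEdges c b) hE havoid
  exact ⟨C, Δ, hC, hΔ, fun β hβ η => by unfold kerE; exact h β hβ η⟩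

variable {N : ℕ} [NeZero N]

/-- With collar `m ≥ b + 1` the chart box of the central `k`-block is made of INTERIOR links of the collar cube (corner `b^k(y − m)`, side
`(2m+1)b^k`). [folklore] -/
theorem chartBox_subset_cubeEdges (𝔟 : BlockSize) (m : ℕ) (hm : 𝔟.b + 1 ≤ m) (k : ℕ) (y : Fin 4 → ℤ) :
    (Fintype.piFinset fun i => Finset.Ico (chartOrigin 𝔟 k y i) (chartOrigin 𝔟 k y i + (chartParams 𝔟 k).sitesPerDir 0)) ×ˢ
        (Finset.univ : Finset (Fin 4)) ⊆
      cubeEdges (fun i => (𝔟.b : ℤ) ^ k * (y i - m)) ((2 * m + 1) * 𝔟.b ^ k) := by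
  intro e he
  have he' := fun j => Finset.mem_Ico.1 (Fintype.mem_piFinset.1 (Finset.mem_product.1 he).1 j)
  have hbk : (1 : ℤ) ≤ (𝔟.b : ℤ) ^ k := 𝔟.one_le_pow k
  have hmb : (𝔟.b : ℤ) + 1 ≤ m := by exact_mod_cast hm
  have hpow : (((chartParams 𝔟 k).sitesPerDir 0 : ℕ) : ℤ) = 2 * 𝔟.b * (𝔟.b : ℤ) ^ k := by
    rw [chartParams_sitesPerDir, Nat.sub_zero]; push_cast; ring
  have hside : (((2 * m + 1) * 𝔟.b ^ k : ℕ) : ℤ) = (2 * m + 1) * (𝔟.b : ℤ) ^ k := by push_cast; ring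
  have hwin : ∀ j, (𝔟.b : ℤ) ^ k * (y j - m) ≤ e.1 j ∧ e.1 j + 1 < (𝔟.b : ℤ) ^ k * (y j - m) + (((2 * m + 1) * 𝔟.b ^ k : ℕ) : ℤ) := by
    intro j
    have h := he' j
    rw [hpow] at h
    simp only [chartOrigin] at h
    rw [hside]
    have e1 : (𝔟.b : ℤ) ^ k * (y j - ((𝔟.b : ℤ) - 1)) = (𝔟.b : ℤ) ^ k * y j - (𝔟.b : ℤ) * (𝔟.b : ℤ) ^ k + (𝔟.b : ℤ) ^ k := by
      ring
    have e2 : (𝔟.b : ℤ) ^ k * (y j - m) = (𝔟.b : ℤ) ^ k * y j - (m : ℤ) * (𝔟.b : ℤ) ^ k := by ring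
    have e3 : ((𝔟.b : ℤ) + 1) * (𝔟.b : ℤ) ^ k ≤ (m : ℤ) * (𝔟.b : ℤ) ^ k := mul_le_mul_of_nonneg_right hmb (by linarith)
    rw [e1] at h
    rw [e2]
    constructor
    · nlinarith [h.1]
    · nlinarith [h.2]
  unfold cubeEdges
  refine Finset.mem_filter.2 ⟨Finset.mem_product.2 ⟨(mem_cubeSites_iff _ _ _).2 fun j => ⟨(hwin j).1, by linarith [(hwin j).2]⟩,
    Finset.mem_univ _⟩, (mem_cubeSites_iff _ _ _).2 fun j => ?_⟩
  have hs : (Pi.single e.2 (1 : ℤ) : Fin 4 → ℤ) j = 0 ∨ (Pi.single e.2 (1 : ℤ) : Fin 4 → ℤ) j = 1 := by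
    rcases eq_or_ne j e.2 with rfl | hj
    · exact Or.inr (by simp)
    · exact Or.inl (by simp [Pi.single_eq_of_ne hj])
  rcases hs with h0 | h1
  · simp only [Pi.add_apply, h0, add_zero]; exact ⟨(hwin j).1, by linarith [(hwin j).2]⟩
  · simp only [Pi.add_apply, h1]; exact ⟨by linarith [(hwin j).1], (hwin j).2⟩

/-- **(UCR_k) AT A FIXED SCALE FROM THE CLASSICAL NO-PENETRATION PROPERTY.**  `SU(N)`, any lattice representation `r`; block size `𝔟`, collar
`m ≥ b + 1`, threshold `ε`, level `k`, block index `y`, orientation `μ < ν`; the collar cube `Q = (b^k(y−m), (2m+1)b^k)`.  Read N20's large-field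
event on the interior links of `Q`: `E := closure {ζ ∈ G^Q | ζ ∨ 1 ∈ largeFieldEvent 𝔟 ε (k,y,μ,ν)}`.  CLASSICAL HYPOTHESIS (zero temperature, no
penetration of the central block): for EVERY exterior `η`, no minimiser of the boundary Wilson action `ζ ↦ S_Q(ζ ∨ η)` lies in `E`.  THEN there are
`C ≥ 0`, `Δ > 0` with `kerE^η_Q(1_{largeFieldEvent 𝔟 ε (k,y,μ,ν)}) ≤ C e^{−βΔ}` for all `β ≥ 0` and ALL exteriors `η` — the one-box bound (UCR_k) at
this block with weight `C e^{−βΔ}`.  HONEST FRAMING: fixed scale only (the constants depend on `k`, `m`, `b`: entropy of the fibre `SU(N)^Q`); the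
k-uniform summability asked by (RM) is the RG content; the classical hypothesis is OPEN and numerically delicate (flat penetration forces central
block fields up to `1 − cos(π²/(2m+1)²)`, LEAD FINDING #50). [folklore] -/
theorem uniformConditionalRarity_of_classicalNoPenetration (r : LatticeRep (Matrix.specialUnitaryGroup (Fin N) ℂ))
    (𝔟 : BlockSize) (m : ℕ) (hm : 𝔟.b + 1 ≤ m) (ε : ℝ) (k : ℕ) (y : Fin 4 → ℤ) (μ ν : Fin 4) (hμν : μ < ν)
    (havoid : ∀ (η : LGConfig 4 (Matrix.specialUnitaryGroup (Fin N) ℂ))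
      (ζ : ↥(cubeEdges (fun i => (𝔟.b : ℤ) ^ k * (y i - m)) ((2 * m + 1) * 𝔟.b ^ k)) → Matrix.specialUnitaryGroup (Fin N) ℂ),
      (∀ ζ', wilsonBoundaryAction r.ρ (cubeEdges (fun i => (𝔟.b : ℤ) ^ k * (y i - m)) ((2 * m + 1) * 𝔟.b ^ k)) (glueWith (cubeEdges (fun i => (𝔟.b : ℤ) ^ k * (y i - m)) ((2 * m + 1) * 𝔟.b ^ k)) ζ η) ≤
          wilsonBoundaryAction r.ρ (cubeEdges (fun i => (𝔟.b : ℤ) ^ k * (y i - m)) ((2 * m + 1) * 𝔟.b ^ k)) (glueWith (cubeEdges (fun i => (𝔟.b : ℤ) ^ k * (y i - m)) ((2 * m + 1) * 𝔟.b ^ k)) ζ' η)) →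
        ζ ∉ closure {ζ | glueWith (cubeEdges (fun i => (𝔟.b : ℤ) ^ k * (y i - m)) ((2 * m + 1) * 𝔟.b ^ k)) ζ (1 : LGConfig 4 (Matrix.specialUnitaryGroup (Fin N) ℂ)) ∈
          largeFieldEvent (N := N) 𝔟 ε ⟨k, y, μ, ν, hμν⟩}) :
    ∃ C Δ : ℝ, 0 ≤ C ∧ 0 < Δ ∧ ∀ β : ℝ, 0 ≤ β → ∀ η : LGConfig 4 (Matrix.specialUnitaryGroup (Fin N) ℂ),
      kerE (Matrix.specialUnitaryGroup (Fin N) ℂ) r β (fun i => (𝔟.b : ℤ) ^ k * (y i - m)) ((2 * m + 1) * 𝔟.b ^ k) η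
        ((largeFieldEvent (N := N) 𝔟 ε ⟨k, y, μ, ν, hμν⟩).indicator fun _ => (1 : ℝ)) ≤ C * Real.exp (-β * Δ) := by
  classical
  haveI := r.secondCountableTopology
  set Λ := cubeEdges (fun i => (𝔟.b : ℤ) ^ k * (y i - m)) ((2 * m + 1) * 𝔟.b ^ k) with hΛ
  set γ : Polymer := ⟨k, y, μ, ν, hμν⟩ with hγ
  set E : Set (↥Λ → Matrix.specialUnitaryGroup (Fin N) ℂ) :=
    closure {ζ | glueWith Λ ζ (1 : LGConfig 4 (Matrix.specialUnitaryGroup (Fin N) ℂ)) ∈ largeFieldEvent (N := N) 𝔟 ε γ} with hEdef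
  obtain ⟨C, Δ, hC, hΔ, h⟩ := kerE_indicator_le_exp_of_minimisers_avoid (Matrix.specialUnitaryGroup (Fin N) ℂ) r
    (fun i => (𝔟.b : ℤ) ^ k * (y i - m)) ((2 * m + 1) * 𝔟.b ^ k) (E := E) isClosed_closure havoid
  refine ⟨C, Δ, hC, hΔ, fun β hβ η => le_trans ?_ (h β hβ η)⟩
  -- monotonicity: the large-field event is contained in `{U : U|_Λ ∈ E}` (a cylinder on the chart box ⊆ Λ)
  haveI := isProbabilityMeasure_ymSpecification r.ρ r.continuous β Λ η
  have hsub : largeFieldEvent (N := N) 𝔟 ε γ ⊆ {U : LGConfig 4 (Matrix.specialUnitaryGroup (Fin N) ℂ) | (fun e : ↥Λ => U e) ∈ E} := by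
    intro U hU
    refine subset_closure ?_
    show glueWith Λ (fun e : ↥Λ => U e) 1 ∈ largeFieldEvent (N := N) 𝔟 ε γ
    have hcyl := isCylinder_indicator_largeFieldEvent (N := N) 𝔟 ε γ
    have hagree : ∀ e ∈ (((Fintype.piFinset fun i => Finset.Ico (chartOrigin 𝔟 γ.k γ.y i)
        (chartOrigin 𝔟 γ.k γ.y i + (chartParams 𝔟 γ.k).sitesPerDir 0)) ×ˢ (Finset.univ : Finset (Fin 4)) :
          Finset (Literature.MathematicalPhysics.QuantumLattice.ZdEdge 4)) : Set _),
        glueWith Λ (fun e : ↥Λ => U e) 1 e = U e := by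
      intro e he
      have heΛ : e ∈ Λ := chartBox_subset_cubeEdges 𝔟 m hm k y (Finset.mem_coe.1 he)
      rw [glueWith_apply_mem _ _ _ heΛ]
    have hval := hcyl hagree
    have h1 : (largeFieldEvent (N := N) 𝔟 ε γ).indicator (fun _ => (1 : ℝ)) U = 1 := by simp [hU]
    rw [h1] at hval
    by_contra hnot
    simp [hnot] at hval
  have hEm : MeasurableSet {U : LGConfig 4 (Matrix.specialUnitaryGroup (Fin N) ℂ) | (fun e : ↥Λ => U e) ∈ E} :=
    (measurable_pi_lambda _ fun e => measurable_pi_apply _) isClosed_closure.measurableSet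
  unfold kerE
  refine integral_mono_of_nonneg (ae_of_all _ fun U => Set.indicator_nonneg (fun _ _ => zero_le_one) _)
    ((integrable_const (1 : ℝ)).indicator hEm) (ae_of_all _ fun U => ?_)
  exact Set.indicator_le_indicator_of_subset hsub (fun _ => zero_le_one) U

end UCR

end Summit.QuantumFields.YangMills.Cruxes.UVSeamRec.DLRPeeling

end
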